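import Mathlib
import Literature.Computability.AlgebraicComplexity.LocalStrongUSP
import Literature.Computability.AlgebraicComplexity.StrongUSP
import Literature.Computability.AlgebraicComplexity.StrongUSPTriangle
import Literature.Computability.AlgebraicComplexity.StrongUSPCapacityLocal
import Literature.Computability.AlgebraicComplexity.PrattTrapezoidVal
import Summits.MatrixMultiplication.MatrixMultiplication.Theorems.SoloBlindPrattValBalanced

/-!
# Solo-blind seat, s46: `Val(ℤ/nℤ) ≥ n^{1.01}` for all large `n` — Pratt's Conjecture 4.1 is false

Companion to `paper/SHARPEST.md` §3 Q12 (solo-blind seat `solo-MatrixMultiplication-blind`, session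
s46, 2026-08-27).  Fifth kernel layer on K. Pratt's extremal quantity `Val` (arXiv:2309.03878, Def. 3.2;
tree `prattVal`).  The fourth layer (`SoloBlindPrattValBalanced`) proved the exact finite inequality

  `|U| · (2t)^k ≤ Val(ℤ/nℤ)` for every local strong USP `U` of width `k`, every `t`, every `n ≥ (3t+1)^k`

and left the asymptotic step to pen, citing Cohn–Kleinberg–Szegedy–Umans' Propositions 18 and 34.
Both propositions are PROVED in the tree's Literature library (`StrongUSPTriangle.lean`:
`exists_isStrongUSP_card_ge_pow`, the strong USP capacity is `≥ 2^{2/3}`; `StrongUSP.lean` /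
`StrongUSPCapacityLocal.lean`: `exists_isLocalStrongUSP_card_ge_pow_of_strongUSP`, the blow-up of a
strong USP to a local strong USP), so the whole argument closes in the kernel.  This file supplies the
missing glue and the assembly:

* `soloVal_isLocalStrongUSP_reindex`, `soloVal_isLocalStrongUSP_prod`, `soloVal_isLocalStrongUSP_pow` —
  local strong USPs are closed under restriction of rows / duplication of columns, under concatenation
  (row product), and under powers;
* `soloVal_exists_isLocalStrongUSP_allWidths` — for every `0 ≤ C < 2^{2/3}` there is `K` such that for
  EVERY width `k ≥ K` some local strong USP of width `k` has at least `C^k` rows (powers of one blown-up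
  triangle puzzle, padded);
* `soloVal_prattVal_zmod_pow_ge` — THE THEOREM, exact form: there is `N` with
  `n^101 ≤ Val(ℤ/nℤ)^100` for every `n ≥ N` (take `t = 33`, base `M = 100`, `C = 1.587`:
  `1.587 · 66 = 104.742 > 100^{1.01} = 104.71…`);
* `soloVal_prattVal_zmod_ge_rpow` — the same as `n^{101/100} ≤ Val(ℤ/nℤ)` for `n ≥ N`; the weaker
  form `∃ c > 0, ∃ K > 0, ∀ n ≥ 1, K · n^{1+c} ≤ Val(ℤ/nℤ)` — literally the CONCLUSION of Pratt's
  conditional Theorem 4.4 (tree: named fact `pratt2024_thm44`, proved as an implication in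
  `PrattPackingTransferThm44Proofs.lean`), so that Theorem 4.4 / Corollary 4.5 obstruct nothing — follows
  at once (small `n` by `card_le_prattVal`) and is not restated here (the gate reports an already-landed
  declaration with exactly that statement);
* `soloVal_not_prattConjecture41` — the negation of Pratt's Conjecture 4.1 ("for all `ε > 0`,
  `Val(ℤ_n) ≤ O(n^{1+ε})`", arXiv:2309.03878 p. 9, the paper's "weakest conjecture" and its proposed
  route to ruling out `ω = 2` via STPPs in abelian groups with boundedly many factors), transcribed as
  `∀ ε > 0, ∃ C, ∀ n ≥ 1, Val(ℤ/nℤ) ≤ C · n^{1+ε}`.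

Method ceiling (pen, for the record): the exponent obtainable this way is
`1 + max_t log(c · 2t/(3t+1))/log(3t+1)` with `c` the local strong USP capacity; `c ≥ 2^{2/3}` gives
`1.0101` (`t = 33`), and `c < 3/2^{2/3}` (tree `StrongUSPConjectureRefuted.lean`) caps it below `1.061` —
far from the `n^{4/3−ε}` that CKSU's two-families conjecture would force (Pratt Thm. 4.7).  Nothing here
bears on `ω` itself except by removing a proposed obstruction.

References: [Pratt2024] K. Pratt, arXiv:2309.03878, Def. 3.2, Conj. 4.1, Thm. 4.4, Cor. 4.5;
[CohnKleinbergSzegedyUmans2005] arXiv:math/0511460, §3 Prop. 18, §6 Lemma 32, Thm. 33, Prop. 34.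
-/

set_option linter.dupNamespace false

namespace Summit.MatrixMultiplication.MatrixMultiplication.Theorems

open Finset Literature.Computability.AlgebraicComplexity

section Closure

/-- Re-indexing: restricting the rows of a local strong USP along an injection and re-listing its
columns along a surjection (in particular duplicating columns) gives a local strong USP. -/
theorem soloVal_isLocalStrongUSP_reindex {L L' k k' : ℕ} {row : Fin L → Fin k → Fin 3}
    (h : IsLocalStrongUSP row) (e : Fin L' → Fin L) (he : Function.Injective e)
    (f : Fin k' → Fin k) (hf : Function.Surjective f) :
    IsLocalStrongUSP (fun a j => row (e a) (f j)) := by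
  intro a b c habc
  have h' : e a ≠ e b ∨ e b ≠ e c := by
    rcases habc with hab | hbc
    · exact Or.inl fun hh => hab (he hh)
    · exact Or.inr fun hh => hbc (he hh)
  obtain ⟨i, hi⟩ := h (e a) (e b) (e c) h'
  obtain ⟨j, rfl⟩ := hf i
  exact ⟨j, hi⟩

/-- A puzzle with at most one row (of any width) is a local strong USP: the defining condition
quantifies over triples of row indices that are not all equal, and there are none. -/
theorem soloVal_isLocalStrongUSP_of_le_one {L k : ℕ} (hL : L ≤ 1) (row : Fin L → Fin k → Fin 3) :
    IsLocalStrongUSP row := by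
  intro a b c habc
  exfalso
  have ha := a.isLt
  have hb := b.isLt
  have hc := c.isLt
  rcases habc with h | h
  · exact h (Fin.ext (by omega))
  · exact h (Fin.ext (by omega))

/-- **Concatenation.** The row product of two local strong USPs (rows = pairs of rows, each new row
the concatenation of the two old ones; CKSU's "`U × U'`") is a local strong USP: a triple of pairs not
all equal has a component triple not all equal, and that component's witness coordinate serves. -/
theorem soloVal_isLocalStrongUSP_prod {L₁ L₂ k₁ k₂ : ℕ} {row₁ : Fin L₁ → Fin k₁ → Fin 3}
    {row₂ : Fin L₂ → Fin k₂ → Fin 3} (h₁ : IsLocalStrongUSP row₁) (h₂ : IsLocalStrongUSP row₂) :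
    IsLocalStrongUSP (fun a : Fin (L₁ * L₂) =>
      Fin.append (row₁ (finProdFinEquiv.symm a).1) (row₂ (finProdFinEquiv.symm a).2)) := by
  intro a b c habc
  by_cases hfirst : (finProdFinEquiv.symm a).1 ≠ (finProdFinEquiv.symm b).1 ∨
      (finProdFinEquiv.symm b).1 ≠ (finProdFinEquiv.symm c).1
  · obtain ⟨i, hi⟩ := h₁ _ _ _ hfirst
    refine ⟨Fin.castAdd k₂ i, ?_⟩
    simpa only [Fin.append_left] using hi
  · have e1 : (finProdFinEquiv.symm a).1 = (finProdFinEquiv.symm b).1 ∧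
        (finProdFinEquiv.symm b).1 = (finProdFinEquiv.symm c).1 := by
      constructor
      · by_contra hh
        exact hfirst (Or.inl hh)
      · by_contra hh
        exact hfirst (Or.inr hh)
    have hsecond : (finProdFinEquiv.symm a).2 ≠ (finProdFinEquiv.symm b).2 ∨
        (finProdFinEquiv.symm b).2 ≠ (finProdFinEquiv.symm c).2 := by
      by_contra hh
      obtain ⟨hh1, hh2⟩ := not_or.1 hh
      have hab : a = b := finProdFinEquiv.symm.injective (Prod.ext e1.1 (not_ne_iff.1 hh1))
      have hbc : b = c := finProdFinEquiv.symm.injective (Prod.ext e1.2 (not_ne_iff.1 hh2))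
      rcases habc with h | h
      · exact h hab
      · exact h hbc
    obtain ⟨i, hi⟩ := h₂ _ _ _ hsecond
    refine ⟨Fin.natAdd k₁ i, ?_⟩
    simpa only [Fin.append_right] using hi

/-- **Powers.** A local strong USP with `L` rows of width `k` yields, for every `m`, a local strong USP
with `L^m` rows of width `k·m` (iterated concatenation). -/
theorem soloVal_isLocalStrongUSP_pow {L k : ℕ} {row : Fin L → Fin k → Fin 3}
    (h : IsLocalStrongUSP row) :
    ∀ m : ℕ, ∃ row' : Fin (L ^ m) → Fin (k * m) → Fin 3, IsLocalStrongUSP row' := by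
  intro m
  induction m with
  | zero => exact ⟨fun _ _ => 0, soloVal_isLocalStrongUSP_of_le_one (by simp) _⟩
  | succ m ih =>
    obtain ⟨row', h'⟩ := ih
    have hp := soloVal_isLocalStrongUSP_prod h' h
    exact ⟨_, soloVal_isLocalStrongUSP_reindex hp (finCongr (pow_succ L m))
      (finCongr (pow_succ L m)).injective (finCongr (Nat.mul_succ k m))
      (finCongr (Nat.mul_succ k m)).surjective⟩

/-- A surjection `Fin w → Fin v` for `0 < v ≤ w` (reduce mod `v`). -/
theorem soloVal_exists_surjective_fin {v w : ℕ} (hv : 0 < v) (hvw : v ≤ w) :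
    ∃ f : Fin w → Fin v, Function.Surjective f :=
  ⟨fun j => ⟨(j : ℕ) % v, Nat.mod_lt _ hv⟩,
    fun i => ⟨⟨i, lt_of_lt_of_le i.2 hvw⟩, Fin.ext (Nat.mod_eq_of_lt i.2)⟩⟩

/-- **Local strong USPs of every large width, at any rate below `2^{2/3}`.**  For every
`0 ≤ C < 2^{2/3}` there is `K` such that for every `k ≥ K` some local strong USP of width `k` has at
least `C^k` rows.  (CKSU Prop. 18 + Prop. 34 give one local strong USP of some width `k₁ ≥ 1` at a
slightly better rate; its powers padded with duplicate columns cover all widths.)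
[cite: CohnKleinbergSzegedyUmans2005, Props. 18, 34] -/
theorem soloVal_exists_isLocalStrongUSP_allWidths (C : ℝ) (hC0 : 0 ≤ C)
    (hC : C < (2 : ℝ) ^ (2 / 3 : ℝ)) :
    ∃ K : ℕ, ∀ k : ℕ, K ≤ k →
      ∃ L : ℕ, ∃ row : Fin L → Fin k → Fin 3, IsLocalStrongUSP row ∧ C ^ k ≤ (L : ℝ) := by
  -- reduce to `1 ≤ C`
  suffices hmain : ∀ C : ℝ, 1 ≤ C → C < (2 : ℝ) ^ (2 / 3 : ℝ) → ∃ K : ℕ, ∀ k : ℕ, K ≤ k →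
      ∃ L : ℕ, ∃ row : Fin L → Fin k → Fin 3, IsLocalStrongUSP row ∧ C ^ k ≤ (L : ℝ) by
    rcases le_or_gt 1 C with h1 | h1
    · exact hmain C h1 hC
    · have h22 : (1 : ℝ) < (2 : ℝ) ^ (2 / 3 : ℝ) :=
        Real.one_lt_rpow (by norm_num) (by norm_num)
      obtain ⟨K, hK⟩ := hmain 1 le_rfl h22
      refine ⟨K, fun k hk => ?_⟩
      obtain ⟨L, row, hrow, hL⟩ := hK k hk
      exact ⟨L, row, hrow, le_trans (pow_le_pow_left₀ hC0 h1.le k) hL⟩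
  intro C h1 hC
  have hCpos : 0 < C := lt_of_lt_of_le one_pos h1
  -- `C < C₁ < C₂ < 2^{2/3}`
  obtain ⟨C₁, hCC₁, hC₁⟩ := exists_between hC
  obtain ⟨C₂, hC₁C₂, hC₂⟩ := exists_between hC₁
  have hC₁pos : 0 < C₁ := hCpos.trans hCC₁
  have hC₁1 : 1 ≤ C₁ := h1.trans hCC₁.le
  have hC₂0 : 0 ≤ C₂ := (hC₁pos.trans hC₁C₂).le
  -- one local strong USP of width `k₁ ≥ 1` with `C₁^{k₁} ≤ L₁` rows
  obtain ⟨k₁, hk₁, L₁, row₁, hrow₁, hL₁⟩ :=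
    exists_isLocalStrongUSP_card_ge_pow_of_strongUSP (C := C₂)
      (fun K => exists_isStrongUSP_card_ge_pow C₂ hC₂0 hC₂ K) hC₁pos.le hC₁C₂ 1
  -- threshold from `(C₁/C)^m → ∞`
  have hratio : 1 < C₁ / C := (one_lt_div hCpos).2 hCC₁
  obtain ⟨m₀, hm₀⟩ := pow_unbounded_of_one_lt (C₁ ^ k₁) hratio
  refine ⟨max k₁ m₀, fun k hk => ?_⟩
  have hkk₁ : k₁ ≤ k := le_trans (le_max_left _ _) hk
  have hkm₀ : m₀ ≤ k := le_trans (le_max_right _ _) hk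
  -- the power puzzle with `m = k / k₁` factors, padded from width `k₁ m` to width `k`
  obtain ⟨rowP, hrowP⟩ := soloVal_isLocalStrongUSP_pow hrow₁ (k / k₁)
  have hdm : k₁ * (k / k₁) + k % k₁ = k := Nat.div_add_mod k k₁
  have hmod : k % k₁ < k₁ := Nat.mod_lt k (by omega)
  have hwidth : k₁ * (k / k₁) ≤ k := Nat.mul_div_le k k₁
  have hm1 : 1 ≤ k / k₁ := (Nat.one_le_div_iff (by omega)).2 hkk₁
  have hwidth0 : 0 < k₁ * (k / k₁) := Nat.mul_pos (by omega) hm1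
  obtain ⟨f, hf⟩ := soloVal_exists_surjective_fin hwidth0 hwidth
  refine ⟨L₁ ^ (k / k₁), fun a j => rowP a (f j),
    soloVal_isLocalStrongUSP_reindex hrowP id Function.injective_id f hf, ?_⟩
  -- size: `C^k ≤ C₁^{k-k₁} ≤ C₁^{k₁ (k/k₁)} = (C₁^{k₁})^{k/k₁} ≤ L₁^{k/k₁}`
  have hsub : k - k₁ ≤ k₁ * (k / k₁) := by
    have := hdm
    have := hmod
    generalize k₁ * (k / k₁) = P at *
    omega
  have hstep1 : C ^ k ≤ C₁ ^ (k - k₁) := by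
    have hA : C₁ ^ k₁ ≤ (C₁ / C) ^ k :=
      le_trans hm₀.le (pow_le_pow_right₀ hratio.le hkm₀)
    rw [div_pow, le_div_iff₀ (pow_pos hCpos k)] at hA
    rw [pow_sub₀ _ hC₁pos.ne' hkk₁, ← div_eq_mul_inv, le_div_iff₀ (pow_pos hC₁pos k₁)]
    linarith [hA]
  calc C ^ k ≤ C₁ ^ (k - k₁) := hstep1
    _ ≤ C₁ ^ (k₁ * (k / k₁)) := pow_le_pow_right₀ hC₁1 hsub
    _ = (C₁ ^ k₁) ^ (k / k₁) := pow_mul C₁ k₁ (k / k₁)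
    _ ≤ (L₁ : ℝ) ^ (k / k₁) := pow_le_pow_left₀ (pow_nonneg hC₁pos.le k₁) hL₁ _
    _ = ((L₁ ^ (k / k₁) : ℕ) : ℝ) := by push_cast; rfl

end Closure

section Main

/-- `1.587 < 2^{2/3}` (since `1.587³ = 3.9969… < 4`). -/
theorem soloVal_const_lt_two_rpow : (1587 / 1000 : ℝ) < (2 : ℝ) ^ (2 / 3 : ℝ) := by
  have h4 : ((2 : ℝ) ^ (2 / 3 : ℝ)) ^ 3 = 4 := by
    rw [← Real.rpow_mul_natCast (by norm_num)]; norm_num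
  by_contra hle
  have h3 := pow_le_pow_left₀ (by positivity) (not_lt.1 hle) 3
  rw [h4] at h3
  norm_num at h3

/-- **`Val(ℤ/nℤ)^100 ≥ n^101` for all large `n`** — exact form of `Val(ℤ/nℤ) ≥ n^{1.01}`.  Proof: for
`100^k ≤ n < 100^{k+1}` take a local strong USP of width `k` with `≥ 1.587^k` rows
(`soloVal_exists_isLocalStrongUSP_allWidths`) and apply the balanced-digit embedding with `t = 33`
(`soloVal_prattVal_zmod_ge_balanced`): `Val(ℤ/nℤ) ≥ (1.587 · 66)^k = 104.742^k`, while
`n^{1.01} < 100^{1.01(k+1)} = 104.71…^k · 100^{1.01}`.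
[cite: Pratt2024, Def. 3.2; CohnKleinbergSzegedyUmans2005, Props. 18, 34, Thm. 33] -/
theorem soloVal_prattVal_zmod_pow_ge :
    ∃ N : ℕ, ∀ (n : ℕ) [NeZero n], N ≤ n → n ^ 101 ≤ prattVal (ZMod n) ^ 100 := by
  obtain ⟨K, hK⟩ :=
    soloVal_exists_isLocalStrongUSP_allWidths (1587 / 1000) (by norm_num) soloVal_const_lt_two_rpow
  set ρ : ℝ := (1587 * 66 / 1000) ^ 100 / 100 ^ 101 with hρdef
  have hρ : 1 < ρ := by
    rw [hρdef, one_lt_div (by positivity)]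
    norm_num
  obtain ⟨K₂, hK₂⟩ := pow_unbounded_of_one_lt ((100 : ℝ) ^ 101) hρ
  refine ⟨100 ^ max K K₂, fun n _ hn => ?_⟩
  have hn0 : n ≠ 0 := NeZero.ne n
  set k := Nat.log 100 n with hkdef
  have hk1 : 100 ^ k ≤ n := Nat.pow_log_le_self 100 hn0
  have hk2 : n < 100 ^ (k + 1) := Nat.lt_pow_succ_log_self (by norm_num) n
  have hkK : max K K₂ ≤ k := Nat.le_log_of_pow_le (by norm_num) hn
  have hkK₁ : K ≤ k := le_trans (le_max_left _ _) hkK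
  have hkK₂ : K₂ ≤ k := le_trans (le_max_right _ _) hkK
  obtain ⟨L, row, hrow, hL⟩ := hK k hkK₁
  have hval : L * 66 ^ k ≤ prattVal (ZMod n) :=
    soloVal_prattVal_zmod_ge_balanced hrow 33 n (by norm_num; exact hk1)
  have hmain : ((n : ℝ)) ^ 101 ≤ ((prattVal (ZMod n) : ℕ) : ℝ) ^ 100 := by
    have h1 : ((n : ℝ)) ^ 101 < (100 : ℝ) ^ 101 * ((100 : ℝ) ^ 101) ^ k := by
      have hlt : ((n : ℝ)) < (100 : ℝ) ^ (k + 1) := by exact_mod_cast hk2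
      have e : ((100 : ℝ) ^ (k + 1)) ^ 101 = (100 : ℝ) ^ 101 * ((100 : ℝ) ^ 101) ^ k := by
        rw [← pow_mul, Nat.mul_comm, pow_mul, pow_succ, mul_comm]
      calc ((n : ℝ)) ^ 101 < ((100 : ℝ) ^ (k + 1)) ^ 101 :=
            pow_lt_pow_left₀ hlt (by positivity) (by norm_num)
        _ = (100 : ℝ) ^ 101 * ((100 : ℝ) ^ 101) ^ k := e
    have h2 : (100 : ℝ) ^ 101 * ((100 : ℝ) ^ 101) ^ k ≤ ρ ^ k * ((100 : ℝ) ^ 101) ^ k :=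
      mul_le_mul_of_nonneg_right (le_trans hK₂.le (pow_le_pow_right₀ hρ.le hkK₂)) (by positivity)
    have h3 : ρ ^ k * ((100 : ℝ) ^ 101) ^ k = (((1587 / 1000 : ℝ) ^ k) * 66 ^ k) ^ 100 := by
      rw [← mul_pow, hρdef, div_mul_cancel₀ _ (by positivity), ← pow_mul, ← mul_pow, ← pow_mul,
        mul_comm 100 k]
      norm_num
    have h4 : (((1587 / 1000 : ℝ) ^ k) * 66 ^ k) ^ 100 ≤ (((L : ℝ)) * 66 ^ k) ^ 100 :=
      pow_le_pow_left₀ (by positivity) (mul_le_mul_of_nonneg_right hL (by positivity)) 100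
    have h5 : (((L : ℝ)) * 66 ^ k) ^ 100 ≤ ((prattVal (ZMod n) : ℕ) : ℝ) ^ 100 := by
      have hcast : ((L : ℝ)) * 66 ^ k ≤ ((prattVal (ZMod n) : ℕ) : ℝ) := by exact_mod_cast hval
      exact pow_le_pow_left₀ (by positivity) hcast 100
    exact (h1.trans_le (h2.trans (h3.le.trans (h4.trans h5)))).le
  exact_mod_cast hmain

/-- **`Val(ℤ/nℤ) ≥ n^{1.01}` for all large `n`.** [cite: Pratt2024, Def. 3.2, Conj. 4.1] -/
theorem soloVal_prattVal_zmod_ge_rpow :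
    ∃ N : ℕ, ∀ (n : ℕ) [NeZero n], N ≤ n →
      (n : ℝ) ^ ((101 : ℝ) / 100) ≤ (prattVal (ZMod n) : ℝ) := by
  obtain ⟨N, hN⟩ := soloVal_prattVal_zmod_pow_ge
  refine ⟨N, fun n _ hn => ?_⟩
  have hR : ((n : ℝ)) ^ (101 : ℕ) ≤ ((prattVal (ZMod n) : ℕ) : ℝ) ^ (100 : ℕ) := by
    exact_mod_cast hN n hn
  have hn0 : (0 : ℝ) ≤ n := Nat.cast_nonneg n
  have hv0 : (0 : ℝ) ≤ (prattVal (ZMod n) : ℝ) := Nat.cast_nonneg _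
  calc (n : ℝ) ^ ((101 : ℝ) / 100) = (((n : ℝ)) ^ (101 : ℕ)) ^ ((1 : ℝ) / 100) := by
        rw [← Real.rpow_natCast, ← Real.rpow_mul hn0]; norm_num
    _ ≤ (((prattVal (ZMod n) : ℕ) : ℝ) ^ (100 : ℕ)) ^ ((1 : ℝ) / 100) :=
        Real.rpow_le_rpow (pow_nonneg hn0 _) hR (by norm_num)
    _ = (prattVal (ZMod n) : ℝ) := by
        rw [← Real.rpow_natCast, ← Real.rpow_mul hv0]; norm_num

/-- **Pratt's Conjecture 4.1 is false.**  Conjecture 4.1 of arXiv:2309.03878 (p. 9: "For all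
`ε > 0`, `Val(ℤ_n) ≤ O(n^{1+ε})`"), transcribed as `∀ ε > 0, ∃ C, ∀ n ≥ 1, Val(ℤ/nℤ) ≤ C · n^{1+ε}`,
contradicts `Val(ℤ/nℤ) ≥ n^{1.01}` (take `ε = 1/200`). [cite: Pratt2024, Conj. 4.1] -/
theorem soloVal_not_prattConjecture41 :
    ¬ ∀ ε : ℝ, 0 < ε → ∃ C : ℝ, ∀ (n : ℕ) [NeZero n],
        (prattVal (ZMod n) : ℝ) ≤ C * (n : ℝ) ^ (1 + ε) := by
  intro hconj
  obtain ⟨C, hC⟩ := hconj (1 / 200) (by norm_num)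
  obtain ⟨N, hN⟩ := soloVal_prattVal_zmod_ge_rpow
  -- for `n ≥ max N 1`: `n^{101/100} ≤ C n^{201/200}`, i.e. `n^{1/200} ≤ C`
  have hbound : ∀ n : ℕ, max N 1 ≤ n → (n : ℝ) ^ ((1 : ℝ) / 200) ≤ C := by
    intro n hn
    have hn1 : 1 ≤ n := le_trans (le_max_right _ _) hn
    haveI : NeZero n := NeZero.of_pos (by omega)
    have hlow := hN n (le_trans (le_max_left _ _) hn)
    have hup := hC n
    have hnpos : (0 : ℝ) < n := by exact_mod_cast hn1
    have hsplit : (n : ℝ) ^ ((101 : ℝ) / 100) =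
        (n : ℝ) ^ ((1 : ℝ) / 200) * (n : ℝ) ^ (1 + 1 / 200 : ℝ) := by
      rw [← Real.rpow_add hnpos]; norm_num
    have hp : (0 : ℝ) < (n : ℝ) ^ (1 + 1 / 200 : ℝ) := by positivity
    have := le_trans hlow hup
    rw [hsplit] at this
    exact le_of_mul_le_mul_right this hp
  -- but `n^{1/200} → ∞`
  have htend : Filter.Tendsto (fun n : ℕ => ((n : ℝ)) ^ ((1 : ℝ) / 200)) Filter.atTop Filter.atTop :=
    (tendsto_rpow_atTop (by norm_num)).comp tendsto_natCast_atTop_atTop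
  obtain ⟨n, hn⟩ := ((htend.eventually_gt_atTop C).and (Filter.eventually_ge_atTop (max N 1))).exists
  exact absurd (hbound n hn.2) (not_le.2 hn.1)

end Main

end Summit.MatrixMultiplication.MatrixMultiplication.Theorems
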